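import Literature.NumberTheory.DiophantineApproximation.RhinViolaIntegrals
import Mathlib.MeasureTheory.Constructions.Pi
import HarnessLib

/-!
# Rhin–Viola 1996: the double integrals `I(h,i,j,k,l)` for `ζ(2)` and the generators `τ, σ, φ` of their
# permutation group — DEFINITIONS, the group bookkeeping, `σ`-invariance, and the bridge to the tree's 2005 family

Topic `Literature/NumberTheory/Irrationality/RhinViola1996` (file 1 of 2: the long change of variables `τ` and the
hypergeometric transformation (3.3) are PROVED in the companion `PermutationGroupZeta2Proofs.lean`). Source: G. Rhin,
C. Viola, *On a permutation group related to ζ(2)*, Acta Arith. **77** (1996) 23–56 [RhinViola1996] (held text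
`paper:doi-10-4064-aa-77-1-23-56`; pp. 23–29, 32, 37–38 read on the page by the filing seat). It is the `ζ(2)`
predecessor of the `ζ(3)` group structure of [RhinViola2001] (`RhinViola2001/GroupStructure.lean`,
`…/GroupStructureProofs.lean`, `…/ThetaInvarianceProofs.lean`). HONEST FRAMING (cell pub-zeta5: systematic search; no
irrationality claim unless certified): identities between double integrals of rational functions and the bookkeeping
of a permutation group; nothing here is an irrationality statement, an irrationality measure or a denominator claim;
nothing about `ζ(5)`, `ζ(3)` or `ζ(2)` beyond print; records in print unmoved.

## What is printed

* §1 p. 24, (1.4) = §2 p. 27, (2.1): for non-negative integers `h, i, j, k, l`,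
  `I(h,i,j,k,l) = ∫₀¹∫₀¹ x^h(1−x)^i y^k(1−y)^j/(1−xy)^{i+j−l} · dx dy/(1−xy)`; p. 27: "the condition for `I(h,i,j,k,l)`
  to be finite is that `h, i, j, k, l` are all non-negative, which we shall henceforth assume."
* §1 p. 25, (1.5) and §2 p. 27: "the transformation `τ` defined by `ξ = (1−x)/(1−xy)`, `η = 1 − xy`, has period 5 and
  maps the unit square `(0,1) × (0,1)` onto itself. Moreover, the function `x(1−x)y(1−y)/(1−xy)` and the measure
  `dx dy/(1−xy)` are invariant under the action of `τ`"; the change of variables `τ⁻¹ : x = 1 − ξη, y = (1−η)/(1−ξη)`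
  turns `J₀ = I(h,i,j,k,l)` into `J₁ = I(i,j,k,l,h)`, "so that with the action of `τ` on `J₀` we associate the cyclic
  permutation `τ = (h i j k l)`" ((2.2)–(2.3); for complex parameters the cyclic invariance is Dixon's, 1905, ref. [2]).
* §2 p. 28: "by applying to `I(h,i,j,k,l)` the transformation `σ : ξ = y, η = x`, i.e. by interchanging the variables
  `x, y` in the integral, we get `I(k,j,i,h,l)`" … `σ = (h k)(i j)` … "the permutation group `⟨τ, σ⟩` … is isomorphic to
  the dihedral group `D₅` of order 10, and the value of `I(h,i,j,k,l)` is invariant under the action of `⟨τ, σ⟩`."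
* §1 p. 26, (1.8)–(1.9): §3 requires that "not only `h, i, j, k, l` but also `j+k−h, k+l−i, l+h−j, h+i−k, i+j−l` are
  non-negative"; §3 p. 37, (3.2)–(3.4): Euler's integral for `₂F₁` and `F(α,β;γ;y) = F(β,α;γ;y)` give (3.2), and
  "multiplying by `y^k(1−y)^j` and integrating in `0 ≤ y ≤ 1` we obtain, by (2.1),
  (3.3) `I(h,i,j,k,l)/(h! i!) = I(i+j−l, l+h−j, j, k, l)/((i+j−l)!(l+h−j)!)`"; p. 37: on the ten integers
  `φ = (h  i+j−l)(i  l+h−j)(j+k−h  k+l−i)`; p. 38: `τ = (h i j k l)(j+k−h  k+l−i  l+h−j  h+i−k  i+j−l)`,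
  `σ = (h k)(i j)(j+k−h  h+i−k)(k+l−i  l+h−j)`, and `Φ = ⟨φ, τ, σ⟩ ≅ S₅` acting on the five sums `h+i, i+j, j+k, k+l, l+h`.

## What is typed (definitions with bodies) and PROVED here — no named fact, net debt 0

DEFINITIONS: `Params` (`h, i, j, k, l : ℤ` — integers, so that `τ, σ, φ` are everywhere-defined maps of `ℤ⁵`; the
paper's sign conditions (1.8)–(1.9) are the predicate `Params.Admissible`), `Params.aux` (the five integers (1.9)),
`Params.Nonneg`, `Params.Admissible`, `square` (the OPEN unit square of `Fin 2 → ℝ`), `integrand` and `I` ((1.4)/(2.1)),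
`tau`, `sigma`, `phi`. `I` is a real-valued (Bochner) set integral over the open square rather than a lower Lebesgue
integral: this is the shape of the tree's `RhinViola2001.I` (ζ(3)) and `RhinViola.I0` (below), of Mathlib's
change-of-variables formula, and it makes (3.3) an equation of reals; for non-negative parameters it is the printed
(finite, p. 27) value, and none of the transformation theorems needs a finiteness hypothesis.
EXISTING TREE VOCABULARY — REUSED, NOT RE-DECLARED: the tree holds Rhin–Viola's 2005 dilogarithm family
`DiophantineApproximation.RhinViola.I0 z h j k l m` over the closed square `ViolaZudilin.unitSquare ⊆ ℝ × ℝ`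
(`DiophantineApproximation/RhinViolaIntegrals.lean`). The family (1.4) is its `z = 1` member up to the flip
`(x,y) ↦ (1−x,1−y)` — PROVED below as `I_eq_I0_one : I ⟨h,i,j,k,l⟩ = RhinViola.I0 1 h i j k l` for natural parameters.
The integer-parameter / open-square / `Fin 2 → ℝ` presentation is kept only because the group acts on `ℤ⁵` and
Mathlib's Jacobian API (`LinearMap.toMatrix'`, `Matrix.det_fin_two`) wants `Fin n → ℝ` (as `RhinViola2001.cube` does);
Euler's exchange (3.2) is likewise the tree's `RhinViola.euler_integral_symm_nat` (companion file).
PROVED: `tau_pow_five`, `sigma_sigma`, `phi_phi`, `aux_tau`, `aux_sigma`, `aux_phi` (the generators permute the ten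
integers (1.8)–(1.9) as printed on pp. 37–38), `admissible_tau` / `admissible_sigma` / `admissible_phi`,
`invariance_sigma` (`I(σP) = I(P)` for all integer parameters: the coordinate swap is a measure-preserving equivalence
of `Fin 2 → ℝ`), `I_eq_I0_one`. Companion file: `invariance_tau`, `hypergeometric_phi` ((3.3)), `invariance_word`.
NOT typed (quoting them unproved would mint named facts): Theorem 2.1 (p. 29: `J₀ = a − bζ(2)`, `b ∈ ℤ`,
`d_{M₀} d_{N₀} a ∈ ℤ`), Theorem 2.2 (p. 32), Theorems 4.1–4.2 (pp. 46–47, the `p`-adic divisibilities), Theorem 5.1 and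
§5 (`μ(ζ(2)) < 5.441243`), `|Φ| = 120`.
-/

noncomputable section

open MeasureTheory Set intervalIntegral
open scoped Nat

namespace Literature.NumberTheory.Irrationality.RhinViola1996

/-! ### §2: parameters, the double integral (2.1), the generators -/

/-- The five integer parameters `h, i, j, k, l` of (2.1). [cite: RhinViola1996, §2 (2.1), p. 27] -/
@[ext] structure Params where
  h : ℤ
  i : ℤ
  j : ℤ
  k : ℤ
  l : ℤ

namespace Params

/-- The five auxiliary integers `j+k−h, k+l−i, l+h−j, h+i−k, i+j−l` of (1.9), again as a `Params`, in this order.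
[cite: RhinViola1996, §1 (1.9), p. 26; §3 p. 37] -/
def aux (P : Params) : Params :=
  ⟨P.j + P.k - P.h, P.k + P.l - P.i, P.l + P.h - P.j, P.h + P.i - P.k, P.i + P.j - P.l⟩

/-- All five parameters are non-negative ((1.8); "the condition for `I(h,i,j,k,l)` to be finite").
[cite: RhinViola1996, §2 p. 27] -/
def Nonneg (P : Params) : Prop := 0 ≤ P.h ∧ 0 ≤ P.i ∧ 0 ≤ P.j ∧ 0 ≤ P.k ∧ 0 ≤ P.l

/-- The standing assumption of §3: the ten integers (1.8)–(1.9) are non-negative.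
[cite: RhinViola1996, §3 p. 37 ("we choose five non-negative integers … such that … are also non-negative")] -/
def Admissible (P : Params) : Prop := P.Nonneg ∧ P.aux.Nonneg

end Params

/-- The open unit square `(0,1)²` (coordinates `p 0 = x`, `p 1 = y`). [cite: RhinViola1996, §2 p. 27] -/
def square : Set (Fin 2 → ℝ) := {p | ∀ i, p i ∈ Ioo (0 : ℝ) 1}

/-- The integrand of (2.1): `x^h(1−x)^i y^k(1−y)^j/(1−xy)^{i+j−l+1}` (integer exponents).
[cite: RhinViola1996, §2 (2.1), p. 27] -/
def integrand (P : Params) (p : Fin 2 → ℝ) : ℝ :=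
  p 0 ^ P.h * (1 - p 0) ^ P.i * p 1 ^ P.k * (1 - p 1) ^ P.j / (1 - p 0 * p 1) ^ (P.i + P.j - P.l + 1)

/-- **`I(h,i,j,k,l)`**, the double integral (1.4)/(2.1) over the open unit square, as a real-valued (Bochner) set
integral (junk `0` where the integrand is not integrable; "the condition for `I(h,i,j,k,l)` to be finite is that
`h, i, j, k, l` are all non-negative", p. 27). For natural parameters it is the `z = 1` member of the tree's
`RhinViola.I0` (`I_eq_I0_one`). [cite: RhinViola1996, §1 (1.4), p. 24; §2 (2.1), p. 27] -/
def I (P : Params) : ℝ := ∫ p in square, integrand P p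

/-- The action of `τ` on the parameters: `I(h,i,j,k,l) ↦ I(i,j,k,l,h)`, the cyclic permutation `τ = (h i j k l)`.
[cite: RhinViola1996, §2 (2.2)–(2.3), pp. 27–28] -/
def tau (P : Params) : Params := ⟨P.i, P.j, P.k, P.l, P.h⟩

/-- The action of `σ : x ↔ y`: `I(h,i,j,k,l) ↦ I(k,j,i,h,l)`, `σ = (h k)(i j)`. [cite: RhinViola1996, §2 p. 28] -/
def sigma (P : Params) : Params := ⟨P.k, P.j, P.i, P.h, P.l⟩

/-- The action of the hypergeometric transformation (3.3): `(h,i,j,k,l) ↦ (i+j−l, l+h−j, j, k, l)`, i.e.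
`φ = (h  i+j−l)(i  l+h−j)(j+k−h  k+l−i)`. [cite: RhinViola1996, §3 (3.3)–(3.4), p. 37] -/
def phi (P : Params) : Params := ⟨P.i + P.j - P.l, P.l + P.h - P.j, P.j, P.k, P.l⟩

/-- "`τ` has period 5" (on the parameters). [cite: RhinViola1996, §2 p. 27] -/
theorem tau_pow_five (P : Params) : tau (tau (tau (tau (tau P)))) = P := rfl

/-- `σ` is an involution. [cite: RhinViola1996, §2 p. 28] -/
theorem sigma_sigma (P : Params) : sigma (sigma P) = P := rfl

/-- `φ` is an involution. [cite: RhinViola1996, §3 p. 37] -/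
theorem phi_phi (P : Params) : phi (phi P) = P := by
  ext <;> simp only [phi] <;> ring

/-- `τ` permutes the auxiliary integers cyclically: `τ = (h i j k l)(j+k−h  k+l−i  l+h−j  h+i−k  i+j−l)` (p. 38).
[cite: RhinViola1996, §3 p. 38] -/
theorem aux_tau (P : Params) : (tau P).aux = tau P.aux := by
  ext <;> simp only [Params.aux, tau]

/-- `σ = (h k)(i j)(j+k−h  h+i−k)(k+l−i  l+h−j)` on the ten integers (p. 38): on the auxiliary integers `σ` acts
by the same pattern. [cite: RhinViola1996, §3 p. 38] -/
theorem aux_sigma (P : Params) : (sigma P).aux = sigma P.aux := by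
  ext <;> simp only [Params.aux, sigma] <;> ring

/-- `φ` permutes the ten integers (1.8)–(1.9): on the auxiliary integers it acts by
`(j+k−h  k+l−i)`, `h ↔ i+j−l`, `i ↔ l+h−j` (p. 37: "ϕ(j+k−h) = k+l−i = … = ϕ(j)+ϕ(k)−ϕ(h)").
[cite: RhinViola1996, §3 p. 37] -/
theorem aux_phi (P : Params) : (phi P).aux = ⟨P.aux.i, P.aux.h, P.i, P.aux.k, P.h⟩ := by
  ext <;> simp only [phi, Params.aux] <;> ring

/-- The generators preserve admissibility (they permute the ten non-negative integers).
[cite: RhinViola1996, §3 p. 38] -/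
theorem admissible_tau {P : Params} (hP : P.Admissible) : (tau P).Admissible := by
  obtain ⟨⟨_, _, _, _, _⟩, _, _, _, _, _⟩ := hP
  simp only [Params.Admissible, Params.Nonneg, Params.aux, tau] at *
  omega

/-- `σ` preserves admissibility. [cite: RhinViola1996, §3 p. 38] -/
theorem admissible_sigma {P : Params} (hP : P.Admissible) : (sigma P).Admissible := by
  obtain ⟨⟨_, _, _, _, _⟩, _, _, _, _, _⟩ := hP
  simp only [Params.Admissible, Params.Nonneg, Params.aux, sigma] at *
  omega

/-- `φ` preserves admissibility. [cite: RhinViola1996, §3 p. 38] -/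
theorem admissible_phi {P : Params} (hP : P.Admissible) : (phi P).Admissible := by
  obtain ⟨⟨_, _, _, _, _⟩, _, _, _, _, _⟩ := hP
  simp only [Params.Admissible, Params.Nonneg, Params.aux, phi] at *
  omega

/-- The open unit square (the domain of (2.1)) is a measurable set. [cite: RhinViola1996, §2 (2.1), p. 27] -/
theorem measurableSet_square : MeasurableSet square := by
  have : square = Set.pi univ (fun _ => Ioo (0 : ℝ) 1) := by ext p; simp [square]
  rw [this]
  exact MeasurableSet.univ_pi fun _ => measurableSet_Ioo

/-- For `x ≤ 1` and `0 < y < 1` the denominator `1 − xy` is positive. [folklore] -/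
private theorem den_pos_xy {x y : ℝ} (hx1 : x ≤ 1) (hy0 : 0 < y) (hy1 : y < 1) : 0 < 1 - x * y := by
  nlinarith [mul_nonneg (sub_nonneg.2 hx1) hy0.le]

/-! ### `σ`: the coordinate swap -/

/-- Interchanging `x, y` turns the integrand of `P` into that of `σP` ("we get `I(k,j,i,h,l)`").
[cite: RhinViola1996, §2 p. 28] -/
theorem integrand_sigma (P : Params) (p : Fin 2 → ℝ) :
    integrand (sigma P) p = integrand P (p ∘ Equiv.swap 0 1) := by
  have e0 : (Equiv.swap (0 : Fin 2) 1) 0 = 1 := Equiv.swap_apply_left _ _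
  have e1 : (Equiv.swap (0 : Fin 2) 1) 1 = 0 := Equiv.swap_apply_right _ _
  have hexp : P.j + P.i - P.l + 1 = P.i + P.j - P.l + 1 := by ring
  simp only [integrand, sigma, Function.comp, e0, e1, hexp]
  ring_nf

/-- **Invariance under `σ`** (PROVED; holds for all integer parameters): `I(k,j,i,h,l) = I(h,i,j,k,l)` — the swap
`x ↔ y` preserves Lebesgue measure and the square. [cite: RhinViola1996, §2 p. 28] -/
theorem invariance_sigma (P : Params) : I (sigma P) = I P := by
  set e := MeasurableEquiv.piCongrLeft (fun _ : Fin 2 => ℝ) (Equiv.swap (0 : Fin 2) 1) with he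
  have hmp : MeasurePreserving e volume volume :=
    volume_measurePreserving_piCongrLeft (fun _ : Fin 2 => ℝ) (Equiv.swap (0 : Fin 2) 1)
  have he_apply : ∀ p : Fin 2 → ℝ, (e p) = p ∘ Equiv.swap (0 : Fin 2) 1 := by
    intro p; funext i
    rw [he, MeasurableEquiv.coe_piCongrLeft, Equiv.piCongrLeft_apply_eq_cast]
    simp only [cast_eq, Equiv.symm_swap, Function.comp]
  have hset : e ⁻¹' square = square := by
    ext p
    simp only [Set.mem_preimage, square, Set.mem_setOf_eq, he_apply, Function.comp]
    constructor
    · intro h i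
      have := h (Equiv.swap (0 : Fin 2) 1 i)
      rwa [Equiv.swap_apply_self] at this
    · intro h i
      exact h _
  calc I (sigma P) = ∫ p in e ⁻¹' square, integrand P (e p) := by
        rw [hset]; unfold I
        simp only [he_apply, integrand_sigma P]
    _ = I P := hmp.setIntegral_preimage_emb e.measurableEmbedding _ _

/-! ### The family (1.4)/(2.1) is the `z = 1` member of the tree's Rhin–Viola 2005 family `RhinViola.I0` -/

/-- The coordinate flip `(x, y) ↦ (1 − x, 1 − y)` of `ℝ²` (plumbing for `I_eq_I0_one`). [folklore] -/
private def flip2 (q : ℝ × ℝ) : ℝ × ℝ := (1 - q.1, 1 - q.2)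

/-- The flip preserves Lebesgue measure on `ℝ²`. [folklore] -/
private theorem measurePreserving_flip2 : MeasurePreserving flip2 volume volume := by
  rw [Measure.volume_eq_prod]
  exact ((volume : Measure ℝ).measurePreserving_sub_left 1).prod
    ((volume : Measure ℝ).measurePreserving_sub_left 1)

/-- The flip maps the open square onto itself (as a preimage). [folklore] -/
private theorem flip2_preimage_Ioo : flip2 ⁻¹' (Ioo (0:ℝ) 1 ×ˢ Ioo (0:ℝ) 1) = Ioo (0:ℝ) 1 ×ˢ Ioo (0:ℝ) 1 := by
  ext q
  simp only [flip2, mem_preimage, mem_prod, mem_Ioo]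
  constructor
  · rintro ⟨⟨h1, h2⟩, h3, h4⟩; exact ⟨⟨by linarith, by linarith⟩, by linarith, by linarith⟩
  · rintro ⟨⟨h1, h2⟩, h3, h4⟩; exact ⟨⟨by linarith, by linarith⟩, by linarith, by linarith⟩

/-- Invariance of the set integral over the open square under the flip, for a measurable integrand. [folklore] -/
private theorem setIntegral_flip2 {G : ℝ × ℝ → ℝ} (hG : Measurable G) :
    ∫ q in Ioo (0:ℝ) 1 ×ˢ Ioo (0:ℝ) 1, G (flip2 q) = ∫ q in Ioo (0:ℝ) 1 ×ˢ Ioo (0:ℝ) 1, G q := by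
  have hS : MeasurableSet (Ioo (0:ℝ) 1 ×ˢ Ioo (0:ℝ) 1) := measurableSet_Ioo.prod measurableSet_Ioo
  have hres := measurePreserving_flip2.restrict_preimage hS
  rw [flip2_preimage_Ioo] at hres
  change ∫ q, G (flip2 q) ∂(volume.restrict (Ioo (0:ℝ) 1 ×ˢ Ioo (0:ℝ) 1)) =
    ∫ q, G q ∂(volume.restrict (Ioo (0:ℝ) 1 ×ˢ Ioo (0:ℝ) 1))
  rw [← integral_map measurePreserving_flip2.measurable.aemeasurable hG.aestronglyMeasurable, hres.map_eq]

/-- The open square of `Fin 2 → ℝ` is the preimage of `(0,1) × (0,1)` under `f ↦ (f 0, f 1)`. [folklore] -/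
private theorem square_eq_preimage :
    square = MeasurableEquiv.finTwoArrow ⁻¹' (Ioo (0:ℝ) 1 ×ˢ Ioo (0:ℝ) 1) := by
  ext p
  simp only [square, mem_setOf_eq, mem_preimage, mem_prod, Fin.forall_fin_two]
  rfl

/-- The closed square `[0,1]²` and the open square `(0,1)²` of `ℝ²` agree almost everywhere. [folklore] -/
private theorem unitSquare_ae_eq_Ioo :
    (DiophantineApproximation.ViolaZudilin.unitSquare : Set (ℝ × ℝ)) =ᵐ[volume] Ioo (0:ℝ) 1 ×ˢ Ioo (0:ℝ) 1 := by
  rw [Measure.volume_eq_prod]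
  exact Measure.set_prod_ae_eq Ioo_ae_eq_Icc.symm Ioo_ae_eq_Icc.symm

/-- The pointwise dictionary: at `(x, y) ∈ (0,1)²`, Rhin–Viola 2005's integrand at `z = 1` and parameters
`(h, i, j, k, l)`, evaluated at the flipped point `(1 − x, 1 − y)` (where its denominator `X(1−Y) + Y` becomes
`1 − xy`), is the integrand (2.1) of the present file. [cite: RhinViola1996, §2 (2.1); RhinViola2005, (2.1)] -/
private theorem integrand05_flip2 (h i j k l : ℕ) {q : ℝ × ℝ} (hq : q ∈ Ioo (0:ℝ) 1 ×ˢ Ioo (0:ℝ) 1) :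
    DiophantineApproximation.RhinViola.integrand 1 h i j k l (flip2 q) = integrand ⟨h, i, j, k, l⟩ ![q.1, q.2] := by
  obtain ⟨hx, hy⟩ := hq
  have hW : (1 - q.1 * q.2) ≠ 0 := (den_pos_xy hx.2.le hy.1 hy.2).ne'
  simp only [DiophantineApproximation.RhinViola.integrand, DiophantineApproximation.ViolaZudilin.denom₁, flip2,
    integrand, Matrix.cons_val_zero, Matrix.cons_val_one, zpow_natCast]
  have eD : (1 - q.1) * (1 - (1 - q.2)) + (1 - q.2) * 1 = 1 - q.1 * q.2 := by ring
  rw [eD, sub_sub_cancel, sub_sub_cancel,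
    show ((i : ℤ) + j - l + 1) = ((i + j + 1 : ℕ) : ℤ) - (l : ℕ) by push_cast; ring,
    zpow_sub₀ hW, zpow_natCast, zpow_natCast]
  field_simp

/-- **The family (1.4)/(2.1) already lives in the tree**: for natural parameters, `I(h,i,j,k,l)` is the `z = 1`
member `I_1^{(0)}(h,i,j,k,l)` of Rhin–Viola's 2005 dilogarithm family `RhinViola.I0 z h j k l m`
(`DiophantineApproximation/RhinViolaIntegrals.lean`, integrals over the closed square `ViolaZudilin.unitSquare ⊆ ℝ²`
of `X^j(1−X)^h Y^k(1−Y)^l D^m/D^{j+k+1}`, `D = X(1−Y) + Yz`): at `z = 1` the flip `(X,Y) = (1−x, 1−y)` turns `D`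
into `1 − xy` and the monomials into `x^h(1−x)^i y^k(1−y)^j`, the closed and open squares differ by a null set, and
`ℝ²` vs `Fin 2 → ℝ` is Mathlib's `volume_preserving_finTwoArrow`. (The present file keeps integer parameters and
the open square of `Fin 2 → ℝ` because the group acts ℤ-linearly on `ℤ⁵` and Mathlib's Jacobian API wants
`Fin 2 → ℝ`; this theorem is the bridge, so nothing is vendored twice.) [cite: RhinViola1996, §1 (1.4), §2 (2.1)] -/
theorem I_eq_I0_one (h i j k l : ℕ) :
    I ⟨h, i, j, k, l⟩ = DiophantineApproximation.RhinViola.I0 1 h i j k l := by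
  have hG := DiophantineApproximation.RhinViola.measurable_integrand 1 h i j k l
  rw [DiophantineApproximation.RhinViola.I0, one_zpow, one_mul, setIntegral_congr_set unitSquare_ae_eq_Ioo,
    ← setIntegral_flip2 hG]
  rw [setIntegral_congr_fun (measurableSet_Ioo.prod measurableSet_Ioo) fun q hq => integrand05_flip2 h i j k l hq]
  unfold I
  rw [square_eq_preimage]
  have hT := (volume_preserving_finTwoArrow ℝ).setIntegral_preimage_emb
    (MeasurableEquiv.finTwoArrow (α := ℝ)).measurableEmbedding
    (fun q : ℝ × ℝ => integrand ⟨h, i, j, k, l⟩ ![q.1, q.2]) (Ioo (0:ℝ) 1 ×ˢ Ioo (0:ℝ) 1)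
  rw [← hT]
  refine setIntegral_congr_fun (by rw [← square_eq_preimage]; exact measurableSet_square) fun p _ => ?_
  congr 1
  funext m
  fin_cases m <;> rfl

end Literature.NumberTheory.Irrationality.RhinViola1996

end
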